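import Mathlib
import Summits.ResolutionOfSingularities.ResolutionOfSingularities.Theorems.SyzygyFlatteningDefs
import Summits.ResolutionOfSingularities.ResolutionOfSingularities.Theorems.SyzygyFlatteningHigherRankTerminationTowerStageBasic
import Summits.ResolutionOfSingularities.ResolutionOfSingularities.Theorems.SyzygyFlatteningHigherRankTerminationLocAt
import Literature.AlgebraicGeometry.Resolution.IntegralClosureEssFiniteType
import Literature.AlgebraicGeometry.Resolution.ModuleBlowup
import HarnessLib

/-!
# The stages of the syzygy-flattening tower stay essentially of finite type

Crux `HigherRankTermination` (stmt-ResolutionOfSingularities-17045), line `birth`: the three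
registered "finiteness bookkeeping" stubs for one step `locAt O (nrm (B[ratios]))` of the
operator (`Theorems/SyzygyFlatteningDefs.lean`), all for Mathlib's class
`Algebra.EssFiniteType k S` ("`S` is a localisation of a finite-type `k`-algebra"):

* `stub_essFiniteType_locAt` — `locAt O₁ B` (`B ⊆ O₁`) is a localisation of `B` (at the
  `O₁`-units of `B`), hence essentially of finite type over `k` when `B` is
  (`Algebra.EssFiniteType.of_isLocalization` + `Algebra.EssFiniteType.comp`);
* `stub_essFiniteType_nrm` — `nrm C`, whose carrier is exactly the set of elements of `K`
  integral over `C` (`mem_nrm_iff`), is module-finite over `C` when `C` is a domain essentially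
  of finite type over a field with `Frac C = K` (E. Noether / Liu 2002 Prop. 4.1.27, tree lemma
  `module_finite_integralClosure_of_essFiniteType`), hence essentially of finite type over `k`;
* `stub_essFiniteType_adjoinRatios` — adjoining to `B` ALL the ratios `det (ι g) / det (ι x)`
  (`g` over `r`-tuples of a finite `B`-module `M`, `ι : M → B^r`) adjoins, up to `B`-linear
  combinations, only finitely many elements, because the ideal of maximal minors
  `normIdeal ι` is finitely generated (tree lemma `normIdeal_fg`); so the result is `B[R₀]`
  for a finite `R₀` (`adjoin_ratios_eq_adjoin_finset`) and essentially of finite type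
  (tree lemma `essFiniteType_adjoin`).

All folklore.
-/

noncomputable section

-- single-problem summit: the doubled namespace component `ResolutionOfSingularities` is forced
set_option linter.dupNamespace false

namespace Summit.ResolutionOfSingularities.ResolutionOfSingularities.Theorems.SyzygyFlattening

open Literature.AlgebraicGeometry.Resolution

variable {k K : Type} [Field k] [Field K] [Algebra k K]

/-! ## `locAt O₁ B` is a localisation of `B` -/

/-- **STUB `stub_essFiniteType_locAt`.** Localising a model `B ⊆ O₁` essentially of finite
type over `k` at the centre of `O₁` stays essentially of finite type: `locAt O₁ B` is the
localisation of `B` at its `O₁`-units (every element is `a * s⁻¹` with `a, s ∈ B`,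
`O₁.valuation s = 1`, `mem_locAt_iff`, and such `s` are inverted in `locAt O₁ B`,
`inv_mem_locAt`), and localisations of essentially-finite-type algebras are essentially of
finite type. (The hypothesis `Frac B = K` is not needed.) [folklore] -/
theorem stub_essFiniteType_locAt : ∀ (k K : Type) [Field k] [Field K] [Algebra k K]
    (O₁ : ValuationSubring K) (B : Subalgebra k K), B.toSubring ≤ O₁.toSubring →
      IsFractionRing ↥B K → Algebra.EssFiniteType k ↥B → Algebra.EssFiniteType k ↥(locAt O₁ B) := by
  intro k K _ _ _ O₁ B h _ hB
  haveI := hB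
  letI : Algebra ↥B ↥(locAt O₁ B) :=
    (Subalgebra.inclusion (self_le_locAt O₁ B)).toRingHom.toAlgebra
  haveI : IsScalarTower k ↥B ↥(locAt O₁ B) := IsScalarTower.of_algebraMap_eq fun _ => rfl
  haveI : IsLocalization ((IsUnit.submonoid ↥(locAt O₁ B)).comap (algebraMap ↥B ↥(locAt O₁ B)))
      ↥(locAt O₁ B) := by
    refine (isLocalization_iff _ _).mpr ⟨fun s => s.2, fun y => ?_, fun {a b} hab => ?_⟩
    · obtain ⟨a, ha, s, hs, hv, hy⟩ := (mem_locAt_iff O₁ B h).mp y.2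
      have hs0 : s ≠ 0 := ne_zero_of_valuation_eq_one hv
      have hsL : s ∈ locAt O₁ B := self_le_locAt O₁ B hs
      have hunit : IsUnit (algebraMap ↥B ↥(locAt O₁ B) ⟨s, hs⟩) := by
        refine IsUnit.of_mul_eq_one ⟨s⁻¹, inv_mem_locAt O₁ B h hsL hv⟩ (Subtype.ext ?_)
        exact mul_inv_cancel₀ hs0
      refine ⟨(⟨a, ha⟩, ⟨⟨s, hs⟩, hunit⟩), Subtype.ext ?_⟩
      change (y : K) * s = a
      rw [hy, inv_mul_cancel_right₀ hs0]
    · have hab' : (a : K) = b := congrArg (fun t : ↥(locAt O₁ B) => (t : K)) hab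
      exact ⟨1, by rw [Subtype.ext hab']⟩
  haveI : Algebra.EssFiniteType ↥B ↥(locAt O₁ B) :=
    Algebra.EssFiniteType.of_isLocalization ↥(locAt O₁ B)
      ((IsUnit.submonoid ↥(locAt O₁ B)).comap (algebraMap ↥B ↥(locAt O₁ B)))
  exact Algebra.EssFiniteType.comp k ↥B ↥(locAt O₁ B)

/-! ## The normalisation is module-finite -/

/-- The carrier of `nrm C = k[{y | y integral over C}]` IS the set of elements of `K` integral
over `C`: that set is already a `k`-subalgebra (the integral closure of `C` in `K`, with scalars
restricted to `k`). [folklore] -/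
theorem mem_nrm_iff (C : Subalgebra k K) {y : K} : y ∈ nrm C ↔ IsIntegral ↥C y := by
  constructor
  · intro hy
    have hle : nrm C ≤ (integralClosure ↥C K).restrictScalars k :=
      Algebra.adjoin_le fun z hz => hz
    exact hle hy
  · exact fun hy => Algebra.subset_adjoin hy

/-- **STUB `stub_essFiniteType_nrm`.** The normalisation in `K = Frac C` of a domain `C`
essentially of finite type over a field is module-finite over `C` (E. Noether; tree
`module_finite_integralClosure_of_essFiniteType`), hence essentially of finite type over `k`.
[cite: Liu2002, Prop. 4.1.27] -/
theorem stub_essFiniteType_nrm : ∀ (k K : Type) [Field k] [Field K] [Algebra k K]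
    (C : Subalgebra k K), IsFractionRing ↥C K → Algebra.EssFiniteType k ↥C →
      Algebra.EssFiniteType k ↥(nrm C) := by
  intro k K _ _ _ C hC hE
  haveI := hC
  haveI := hE
  -- the integral closure of `C` in `K` is a finite `C`-module
  have hfin : Module.Finite ↥C ↥(integralClosure ↥C K) :=
    module_finite_integralClosure_of_essFiniteType k ↥C K
  -- `nrm C` as a `C`-algebra, through the inclusion `C ≤ nrm C`
  letI : Algebra ↥C ↥(nrm C) := (Subalgebra.inclusion (self_le_nrm C)).toRingHom.toAlgebra
  haveI : IsScalarTower k ↥C ↥(nrm C) := IsScalarTower.of_algebraMap_eq fun _ => rfl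
  -- the identity of `K` restricts to a surjective `C`-algebra map `integralClosure C K → nrm C`
  let f : ↥(integralClosure ↥C K) →ₐ[↥C] ↥(nrm C) :=
    { toFun := fun y => ⟨y, (mem_nrm_iff C).mpr y.2⟩
      map_one' := rfl
      map_mul' := fun _ _ => rfl
      map_zero' := rfl
      map_add' := fun _ _ => rfl
      commutes' := fun _ => rfl }
  have hf : Function.Surjective f := fun z => ⟨⟨z, (mem_nrm_iff C).mp z.2⟩, rfl⟩
  haveI : Algebra.EssFiniteType ↥C ↥(nrm C) := Algebra.EssFiniteType.of_surjective f hf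
  exact Algebra.EssFiniteType.comp k ↥C ↥(nrm C)

/-! ## Adjoining all the Plücker ratios adjoins finitely many -/

section adjoinRatios

variable {B : Subalgebra k K} {M : Type} [AddCommGroup M] [Module ↥B M] {r : ℕ}

/-- The determinant of the matrix of `K`-coordinates `(ι (g i) j : K)` is the image in `K` of the
determinant `det (frameMatrix ι g)` computed in `B`. [folklore] -/
theorem det_coe_eq_coe_det_frameMatrix (ι : M →ₗ[↥B] (Fin r → ↥B)) (g : Fin r → M) :
    Matrix.det (Matrix.of fun i j => ((ι (g i) j : ↥B) : K)) =
      algebraMap ↥B K (frameMatrix ι g).det := by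
  rw [RingHom.map_det]
  rfl

/-- **Finitely many ratios suffice.** For a finite `B`-module `M`, `ι : M → B^r` and a tuple `x`,
there is a finite set `R₀ ⊆ K` with
`k[B ∪ {det (ι g) / det (ι x) | g}] = k[B ∪ R₀]`: the determinants `det (ι g)` span the
finitely generated ideal of maximal minors `normIdeal ι` (`normIdeal_fg`), and one may take for
`R₀` the quotients by `det (ι x)` of finitely many generators. [folklore] -/
theorem adjoin_ratios_eq_adjoin_finset [Module.Finite ↥B M] (ι : M →ₗ[↥B] (Fin r → ↥B))
    (x : Fin r → M) :
    ∃ R₀ : Finset K, Algebra.adjoin k ((B : Set K) ∪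
        {y : K | ∃ g : Fin r → M,
          y = Matrix.det (Matrix.of fun i j => ((ι (g i) j : ↥B) : K)) *
            (Matrix.det (Matrix.of fun i j => ((ι (x i) j : ↥B) : K)))⁻¹}) =
      Algebra.adjoin k ((B : Set K) ∪ ↑R₀) := by
  classical
  set dx : K := Matrix.det (Matrix.of fun i j => ((ι (x i) j : ↥B) : K))
  -- the `B`-span in `K` of the determinants is finitely generated
  have hVfg : (Submodule.span ↥B
      (Set.range fun g : Fin r → M => algebraMap ↥B K (frameMatrix ι g).det)).FG := by
    have h0 : Submodule.FG (normIdeal ι) := normIdeal_fg ι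
    have h := h0.map (Algebra.linearMap ↥B K)
    rw [normIdeal_eq_span, Submodule.map_span, ← Set.range_comp] at h
    exact h
  obtain ⟨T, hT⟩ := hVfg
  refine ⟨T.image fun t => t * dx⁻¹, le_antisymm ?_ ?_⟩
  · apply Algebra.adjoin_le
    rintro y (hy | ⟨g, rfl⟩)
    · exact Algebra.subset_adjoin (Or.inl hy)
    · rw [det_coe_eq_coe_det_frameMatrix]
      have hmem : algebraMap ↥B K (frameMatrix ι g).det ∈ Submodule.span ↥B (↑T : Set K) := by
        rw [hT]; exact Submodule.subset_span ⟨g, rfl⟩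
      refine Submodule.span_induction
        (p := fun v _ => v * dx⁻¹ ∈ Algebra.adjoin k ((B : Set K) ∪ ↑(T.image fun t => t * dx⁻¹)))
        ?_ ?_ ?_ ?_ hmem
      · intro t ht
        exact Algebra.subset_adjoin (Or.inr (by
          rw [Finset.coe_image]
          exact Set.mem_image_of_mem _ ht))
      · rw [zero_mul]; exact zero_mem _
      · intro a b _ _ ha hb
        rw [add_mul]; exact add_mem ha hb
      · intro c a _ ha
        rw [Algebra.smul_def, mul_assoc]
        exact mul_mem (Algebra.subset_adjoin (Or.inl (c : ↥B).2)) ha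
  · apply Algebra.adjoin_le
    rintro y (hy | hy)
    · exact Algebra.subset_adjoin (Or.inl hy)
    · rw [Finset.coe_image] at hy
      obtain ⟨t, ht, rfl⟩ := hy
      have hmem : t ∈ Submodule.span ↥B
          (Set.range fun g : Fin r → M => algebraMap ↥B K (frameMatrix ι g).det) := by
        rw [← hT]; exact Submodule.subset_span ht
      refine Submodule.span_induction
        (p := fun v _ => v * dx⁻¹ ∈ Algebra.adjoin k ((B : Set K) ∪
          {y : K | ∃ g : Fin r → M,
            y = Matrix.det (Matrix.of fun i j => ((ι (g i) j : ↥B) : K)) * dx⁻¹}))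
        ?_ ?_ ?_ ?_ hmem
      · rintro _ ⟨g, rfl⟩
        exact Algebra.subset_adjoin (Or.inr ⟨g, by rw [det_coe_eq_coe_det_frameMatrix]⟩)
      · rw [zero_mul]; exact zero_mem _
      · intro a b _ _ ha hb
        rw [add_mul]; exact add_mem ha hb
      · intro c a _ ha
        rw [Algebra.smul_def, mul_assoc]
        exact mul_mem (Algebra.subset_adjoin (Or.inl (c : ↥B).2)) ha

end adjoinRatios

/-- **STUB `stub_essFiniteType_adjoinRatios`.** Adjoining to `B` the ratios
`det (ι g) / det (ι x)` over ALL tuples `g` adjoins only finitely many elements up to `B`-linear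
combinations (the ideal of maximal minors of a finite module is finitely generated, tree
`normIdeal_fg`), so the result is essentially of finite type when `B` is. [folklore] -/
theorem stub_essFiniteType_adjoinRatios : ∀ (k K : Type) [Field k] [Field K] [Algebra k K]
    (B : Subalgebra k K), Algebra.EssFiniteType k ↥B →
      ∀ (M : Type) [AddCommGroup M] [Module ↥B M], Module.Finite ↥B M →
        ∀ (r : ℕ) (ι : M →ₗ[↥B] (Fin r → ↥B)) (x : Fin r → M),
        Algebra.EssFiniteType k ↥(Algebra.adjoin k ((B : Set K) ∪
          {y : K | ∃ g : Fin r → M,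
            y = Matrix.det (Matrix.of fun i j => ((ι (g i) j : ↥B) : K)) *
              (Matrix.det (Matrix.of fun i j => ((ι (x i) j : ↥B) : K)))⁻¹})) := by
  intro k K _ _ _ B hB M _ _ hM r ι x
  haveI := hB
  haveI := hM
  obtain ⟨R₀, hR₀⟩ := adjoin_ratios_eq_adjoin_finset (k := k) (K := K) ι x
  rw [hR₀, ← Algebra.restrictScalars_adjoin]
  exact essFiniteType_adjoin R₀

end Summit.ResolutionOfSingularities.ResolutionOfSingularities.Theorems.SyzygyFlattening

end
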